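import Summits.RiemannHypothesis.RiemannHypothesis.Theorems.GroundBartaEvenWinsBeyondArchDeflationEdgeLoc3
import Literature.Analysis.ValidatedNumerics.TaylorModelEdgePanel
import Literature.Analysis.ValidatedNumerics.TaylorModelLogEdge
import Literature.NumberTheory.LFunctions.WeilArchTailRegTM
import HarnessLib

/-!
# RiemannHypothesis / GroundBarta — rung 4 (`EvenWinsBeyondArch`, stmt-RiemannHypothesis-18807 / 18085):
# the deflated Temple L-side, XVII c′ — the EDGE panel from local tables (kernel-feasible v2)

Helper file (`--supports stmt-RiemannHypothesis-18807`), RH-free, Mathlib + landed tree files only, no facts.  Prover B,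
speedrun unit `sr-gb-rung-b` (gen 4).  On the last y-panel `k = m − 1` (`y_k = c − h`) the archimedean integrals start/end
inside t-panel `0`: `E(ρ) = ∫_0^{h−ρ} G·Δ²/t` and the panel-0 piece `∫_{h−ρ}^{2h} G·Δ¹/t` of `H` are weighted sums of the
MOVING moments `∫_0^{h−ρ} G t^j dt` (`TaylorModelEdgePanel.tmem_wmom`, `partPolyI`), the other panels of `H` as in file XVI′.
With these, `dt_residualEdgeLocTM` encloses the regular part `T` of the flagged residual (`g(y)Ψ(c−y)` replaced by
`g(y)Ψ̃♮(c−y)`, `WeilArchTailRegTM`), and `dt_residualEdgeL_split` is the log split `R♭(c−s) = −½ g(c−s) log s + T(h−s)`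
consumed by `TaylorModelLogEdge.integral_sq_logEdge_le` (whose exact moments of `q = Poly.shift g c` ARE kernel-cheap, ≈ 3 s).

References: E. Bombieri, Rend. Mat. Acc. Lincei (9) 11 (2000) Thm 2 [Bombieri2000Weil]; K. Makino, M. Berz (2003).

(Part 4 of 4 of this topic; see part 1 for the overview.)
-/

set_option linter.dupNamespace false

noncomputable section

open MeasureTheory Set Filter intervalIntegral
open scoped Topology BigOperators

namespace Summit.RiemannHypothesis.RiemannHypothesis.Theorems.EvenWinsBeyondArch

open Literature.NumberTheory.LFunctions
open Literature.Analysis.ValidatedNumerics Literature.Analysis.ValidatedNumerics.PolyMP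
  Literature.Analysis.ValidatedNumerics.NumericsMP Literature.Analysis.ValidatedNumerics.ExpPoly

/-! ## The regular part of the residual on the edge panel -/

section EdgeResidual

variable {S : ℕ} {c : ℚ} {m Dl : ℕ}

/-- **The v2 Taylor model of the regular part `T` on the edge panel** `k = m − 1`: as `dt_residualLocTM` with the edge arch
models and `g(y)Ψ(c−y)` replaced by `g(y)Ψ̃♮(c−y)` (`weilArchTailRegAnTM`, reflected; data `Qinv, e, pK, C0`). -/
def dt_residualEdgeLocTM (S : ℕ) (c : ℚ) (m Dl K : ℕ) (gp pk : Poly) (tab : ℤ → IPoly × ℤ × ℤ)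
    (Dρ : List (IPoly × Poly)) (mu : ℕ → List MI) (M0 : List MI) (DG0 : IPoly × Poly) (PsiFar Pc Ps Eyp Eym : MI)
    (s1 s2 s3 : MI × MI × Bool × Bool) (Qinv : Poly) (e : ℕ) (pK : Poly) (C0 : MI) : IPoly :=
  let h : ℚ := c / (2 * m)
  let y0 : ℚ := PolyMP.panelCentre h (m - 1)
  let A0 := dt_locI S gp (ofRat S y0)
  let Gy := ttruncI S h Dl A0
  let W : ℕ → IPoly := fun i ↦ (Dρ.getD i default).1
  let pw : ℕ → Poly := fun i ↦ (Dρ.getD i default).2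
  let pole := dt_poleTM S h K Pc Ps Eyp Eym
  let primes := taddI (taddI (dt_primeLocTM S h Dl gp y0 Gy s1) (dt_primeLocTM S h Dl gp y0 Gy s2))
    (dt_primeLocTM S h Dl gp y0 Gy s3)
  let arch := taddI (dt_archEEdgeTM S c m Dl A0 DG0.1 DG0.2) (dt_archHEdgeTM S c m Dl A0 M0 DG0.1 DG0.2 Gy tab mu W pw)
  let psi := tmulI S h Dl Gy (taddI (treflI (weilArchTailRegAnTM S h Dl K Qinv e pK C0))
    (weilArchTailTM S h Dρ (2 * m - 1) PsiFar))
  ttruncI S h Dl (taddI (taddI (taddI (taddI pole primes) arch) psi) (dt_locTM S h Dl pk (ofRat S y0)))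

/-- **The regular part on the edge panel, enclosed (v2).**  `m ≥ 2`, `2h ≤ 1`; data as in `dt_tmem_residualLocTM` plus the
panel-0 G model `DG0` and the `Ψ̃♮`-kernel data. [cite: Bombieri2000Weil, Thm 2 (explicit formula)] -/
theorem dt_tmem_residualEdgeLocTM (hS : 0 < S) (hc : 0 < c) (hm : 2 ≤ m) (hh2 : 2 * (c / (2 * m)) ≤ 1) (Dl : ℕ)
    {K : ℕ} (hK : 0 < K) (gp pk : Poly) {tab : ℤ → IPoly × ℤ × ℤ}
    (htab : ∀ n : ℤ, -(m : ℤ) ≤ n → n ≤ m →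
      TabOK S (2 * (c / (2 * m))) (fun s ↦ Poly.eval gp (2 * (n : ℝ) * ((c / (2 * m) : ℚ) : ℝ) + s))
        (tab n).1 (tab n).2.1 (tab n).2.2)
    (htabl : ∀ n : ℤ, -(m : ℤ) ≤ n → n ≤ m → (tab n).1.length = Dl + 1)
    (Dρ : List (IPoly × Poly)) (hDρl : Dρ.length = 2 * m)
    (hDρ : ∀ i : Fin Dρ.length, 1 ≤ (i : ℕ) →
      TMem S (c / (2 * m)) (fun u ↦ weilArchDensity ((PolyMP.panelCentre (c / (2 * m)) i : ℝ) + u)) (Dρ.get i).1)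
    {mu : ℕ → List MI}
    (hmu : ∀ i, 1 ≤ i → i < 2 * m → ∀ b, b < Dl + 1 →
      MI.mem S (∫ u in (-((c / (2 * m) : ℚ) : ℝ))..((c / (2 * m) : ℚ) : ℝ),
        weilArchDensity (((PolyMP.panelCentre (c / (2 * m)) i : ℚ) : ℝ) + u) * u ^ b) ((mu i).getD b default))
    {M0 : List MI} (hM0 : ∀ j, j < M0.length →
      MI.mem S (∫ t in (0 : ℝ)..(2 * ((c / (2 * m) : ℚ) : ℝ)), weilArchDensityG t * t ^ j) (M0.getD j default))
    (hlenM : gp.length ≤ M0.length + 1)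
    {DG0 : IPoly × Poly}
    (hDG0 : TMem S (c / (2 * m)) (fun u ↦ weilArchDensityG (((PolyMP.panelCentre (c / (2 * m)) 0 : ℚ) : ℝ) + u)) DG0.1)
    {PsiFar Pc Ps Eyp Eym : MI} (hFar : MI.mem S (weilArchTail (2 * (c : ℝ))) PsiFar)
    (hPc : MI.mem S (∫ x in (-(c : ℝ))..c, Poly.eval gp x * Real.cosh (x / 2)) Pc)
    (hPs : MI.mem S (∫ x in (-(c : ℝ))..c, Poly.eval gp x * Real.sinh (x / 2)) Ps)
    (hEyp : MI.mem S (Real.exp ((PolyMP.panelCentre (c / (2 * m)) (m - 1) : ℝ) / 2)) Eyp)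
    (hEym : MI.mem S (Real.exp (-((PolyMP.panelCentre (c / (2 * m)) (m - 1) : ℝ) / 2))) Eym)
    (s1 s2 s3 : MI × MI × Bool × Bool) {w1 L1 w2 L2 w3 L3 : ℝ}
    (hw1 : MI.mem S w1 s1.1) (hL1 : MI.mem S L1 s1.2.1) (hw2 : MI.mem S w2 s2.1) (hL2 : MI.mem S L2 s2.2.1)
    (hw3 : MI.mem S w3 s3.1) (hL3 : MI.mem S L3 s3.2.1)
    {Qinv : Poly} {e : ℕ} (hcheck : weilArchTailRegKernelCheck S (c / (2 * m)) Dl K Qinv e = true) (pK : Poly)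
    {C0 : MI} (hC0 : MI.mem S (Real.log 2 + Real.pi / 4) C0) :
    TMem S (c / (2 * m)) (fun ρ ↦
      (2 * (∫ x in (-(c : ℝ))..c, Poly.eval gp x * Real.cosh (x / 2)) * Real.cosh ((((PolyMP.panelCentre (c / (2 * m)) (m - 1) : ℚ) : ℝ) + ρ) / 2) -
        2 * (∫ x in (-(c : ℝ))..c, Poly.eval gp x * Real.sinh (x / 2)) * Real.sinh ((((PolyMP.panelCentre (c / (2 * m)) (m - 1) : ℚ) : ℝ) + ρ) / 2)) +
      (dt_primeSlotFn gp w1 L1 s1.2.2.1 s1.2.2.2 (((PolyMP.panelCentre (c / (2 * m)) (m - 1) : ℚ) : ℝ) + ρ) + dt_primeSlotFn gp w2 L2 s2.2.2.1 s2.2.2.2 (((PolyMP.panelCentre (c / (2 * m)) (m - 1) : ℚ) : ℝ) + ρ) +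
        dt_primeSlotFn gp w3 L3 s3.2.2.1 s3.2.2.2 (((PolyMP.panelCentre (c / (2 * m)) (m - 1) : ℚ) : ℝ) + ρ)) +
      ((∫ t in Ioc 0 ((c : ℝ) - (((PolyMP.panelCentre (c / (2 * m)) (m - 1) : ℚ) : ℝ) + ρ)),
          weilArchDensityG t * ((2 * Poly.eval gp (((PolyMP.panelCentre (c / (2 * m)) (m - 1) : ℚ) : ℝ) + ρ) - Poly.eval gp ((((PolyMP.panelCentre (c / (2 * m)) (m - 1) : ℚ) : ℝ) + ρ) - t) - Poly.eval gp ((((PolyMP.panelCentre (c / (2 * m)) (m - 1) : ℚ) : ℝ) + ρ) + t)) / t)) +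
        ∫ t in Ioc ((c : ℝ) - (((PolyMP.panelCentre (c / (2 * m)) (m - 1) : ℚ) : ℝ) + ρ)) ((c : ℝ) + (((PolyMP.panelCentre (c / (2 * m)) (m - 1) : ℚ) : ℝ) + ρ)),
          weilArchDensityG t * ((Poly.eval gp (((PolyMP.panelCentre (c / (2 * m)) (m - 1) : ℚ) : ℝ) + ρ) - Poly.eval gp ((((PolyMP.panelCentre (c / (2 * m)) (m - 1) : ℚ) : ℝ) + ρ) - t)) / t)) +
      Poly.eval gp (((PolyMP.panelCentre (c / (2 * m)) (m - 1) : ℚ) : ℝ) + ρ) * (weilArchTailRegAn (((c / (2 * m) : ℚ) : ℝ) + -ρ) + weilArchTail ((c : ℝ) + (((PolyMP.panelCentre (c / (2 * m)) (m - 1) : ℚ) : ℝ) + ρ))) +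
      Poly.eval pk (((PolyMP.panelCentre (c / (2 * m)) (m - 1) : ℚ) : ℝ) + ρ))
      (dt_residualEdgeLocTM S c m Dl K gp pk tab Dρ mu M0 DG0 PsiFar Pc Ps Eyp Eym s1 s2 s3 Qinv e pK C0) := by
  set h : ℚ := c / (2 * m) with hh
  set y0 : ℚ := PolyMP.panelCentre h (m - 1) with hy0
  have hm0 : 0 < m := by omega
  have hmq : (0 : ℚ) < m := by exact_mod_cast hm0
  have hh0 : 0 < h := by rw [hh]; positivity
  have hhle2 : h ≤ 2 := by linarith
  have hgc : Continuous fun x ↦ Poly.eval gp x := Poly.continuous_eval gp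
  have hloc := dt_locI_spec hS gp (mem_ofRat S y0)
  have hGy : TMem S h (fun s ↦ Poly.eval gp ((y0 : ℝ) + s)) (ttruncI S h Dl (dt_locI S gp (ofRat S y0))) :=
    tmem_trunc hh0.le Dl (dt_tmem_locI hS h gp (mem_ofRat S y0))
  have hpole := dt_tmem_poleTM hS hh0.le hhle2 hK hPc hPs (y0 := (y0 : ℝ)) hEyp hEym
  have hpr := tmem_add (tmem_add (dt_tmem_primeLocTM hS hh0.le Dl gp y0 hGy s1 hw1 hL1)
    (dt_tmem_primeLocTM hS hh0.le Dl gp y0 hGy s2 hw2 hL2)) (dt_tmem_primeLocTM hS hh0.le Dl gp y0 hGy s3 hw3 hL3)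
  have hW : ∀ i, 1 ≤ i → i < 2 * m →
      TMem S h (fun u ↦ weilArchDensity (((PolyMP.panelCentre h i : ℚ) : ℝ) + u)) (Dρ.getD i default).1 := by
    intro i hi1 hi2
    have hi : i < Dρ.length := by rw [hDρl]; exact hi2
    have := hDρ ⟨i, hi⟩ hi1
    rwa [List.get_eq_getElem, ← List.getD_eq_getElem (d := default)] at this
  have hlenA : (dt_locI S gp (ofRat S y0)).length ≤ M0.length + 1 := by rw [dt_length_locI]; exact hlenM
  have hE := dt_tmem_archEEdge hS hc hm0 Dl hloc.1 hloc.2 hDG0 DG0.2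
  have hH := dt_tmem_archHEdge (Dl := Dl) hS hc hm hgc hloc.1 hloc.2 hM0 hlenA hDG0 DG0.2 hGy htab htabl hW
    (fun i ↦ (Dρ.getD i default).2) hmu
  -- tails
  have hFar' : MI.mem S (weilArchTail (2 * Dρ.length * h)) PsiFar := by
    have e1 : (2 * Dρ.length * h : ℝ) = 2 * (c : ℝ) := by
      rw [hDρl, hh]; push_cast; field_simp
    rwa [e1]
  have hjfN : 2 * m - 1 < Dρ.length := by rw [hDρl]; omega
  have hfarT := tmem_weilArchTailTM hS hh0 Dρ (by omega : 1 ≤ 2 * m - 1) hjfN hDρ hFar'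
  have hcf : ((PolyMP.panelCentre h (2 * m - 1) : ℚ) : ℝ) = (c : ℝ) + (y0 : ℝ) := by
    rw [hy0, hh, show 2 * m - 1 = m + (m - 1) by omega]; exact (dt_c_add_y0 (c := c) (k := m - 1) hm0).symm
  have hreg := tmem_refl (tmem_weilArchTailRegAnTM hS hh0 (by rw [hh]; exact hh2) hK hcheck pK hC0)
  have hpsi := tmem_mul hS hh0.le Dl hGy (tmem_add hreg hfarT)
  have hpk := dt_tmem_locTM hS hh0.le Dl pk (mem_ofRat S y0)
  have hall := tmem_trunc hh0.le Dl (tmem_add (tmem_add (tmem_add (tmem_add hpole hpr) (tmem_add hE hH)) hpsi) hpk)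
  refine tmem_congr_on hall fun ρ _ ↦ ?_
  rw [hcf]
  have e2 : (c : ℝ) + (y0 : ℝ) + ρ = (c : ℝ) + ((y0 : ℝ) + ρ) := by ring
  rw [e2]

/-- The regular-part model with the two arch pieces supplied as (proven) literals `Etm`, `Htm` (kernel chunking). -/
def dt_residualEdgeLocTM' (S : ℕ) (c : ℚ) (m Dl K : ℕ) (gp pk : Poly)
    (Dρ : List (IPoly × Poly)) (PsiFar Pc Ps Eyp Eym : MI)
    (s1 s2 s3 : MI × MI × Bool × Bool) (Qinv : Poly) (e : ℕ) (pK : Poly) (C0 : MI) (Etm Htm : IPoly) : IPoly :=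
  let h : ℚ := c / (2 * m)
  let y0 : ℚ := PolyMP.panelCentre h (m - 1)
  let A0 := dt_locI S gp (ofRat S y0)
  let Gy := ttruncI S h Dl A0
  let pole := dt_poleTM S h K Pc Ps Eyp Eym
  let primes := taddI (taddI (dt_primeLocTM S h Dl gp y0 Gy s1) (dt_primeLocTM S h Dl gp y0 Gy s2))
    (dt_primeLocTM S h Dl gp y0 Gy s3)
  let arch := taddI Etm Htm
  let psi := tmulI S h Dl Gy (taddI (treflI (weilArchTailRegAnTM S h Dl K Qinv e pK C0))
    (weilArchTailTM S h Dρ (2 * m - 1) PsiFar))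
  ttruncI S h Dl (taddI (taddI (taddI (taddI pole primes) arch) psi) (dt_locTM S h Dl pk (ofRat S y0)))

/-- **The regular part on the edge panel from arch literals.** [cite: Bombieri2000Weil, Thm 2 (explicit formula)] -/
theorem dt_tmem_residualEdgeLocTM' (hS : 0 < S) (hc : 0 < c) (hm : 2 ≤ m) (hh2 : 2 * (c / (2 * m)) ≤ 1) (Dl : ℕ)
    {K : ℕ} (hK : 0 < K) (gp pk : Poly)
    (Dρ : List (IPoly × Poly)) (hDρl : Dρ.length = 2 * m)
    (hDρ : ∀ i : Fin Dρ.length, 1 ≤ (i : ℕ) →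
      TMem S (c / (2 * m)) (fun u ↦ weilArchDensity ((PolyMP.panelCentre (c / (2 * m)) i : ℝ) + u)) (Dρ.get i).1)
    {Etm Htm : IPoly} (hE : TMem S (c / (2 * m)) (fun ρ ↦ ∫ t in Ioc 0 ((c : ℝ) - (((PolyMP.panelCentre (c / (2 * m)) (m - 1) : ℚ) : ℝ) + ρ)),
        weilArchDensityG t * ((2 * Poly.eval gp (((PolyMP.panelCentre (c / (2 * m)) (m - 1) : ℚ) : ℝ) + ρ) - Poly.eval gp ((((PolyMP.panelCentre (c / (2 * m)) (m - 1) : ℚ) : ℝ) + ρ) - t) - Poly.eval gp ((((PolyMP.panelCentre (c / (2 * m)) (m - 1) : ℚ) : ℝ) + ρ) + t)) / t)) Etm)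
    (hH : TMem S (c / (2 * m)) (fun ρ ↦ ∫ t in Ioc ((c : ℝ) - (((PolyMP.panelCentre (c / (2 * m)) (m - 1) : ℚ) : ℝ) + ρ)) ((c : ℝ) + (((PolyMP.panelCentre (c / (2 * m)) (m - 1) : ℚ) : ℝ) + ρ)),
        weilArchDensityG t * ((Poly.eval gp (((PolyMP.panelCentre (c / (2 * m)) (m - 1) : ℚ) : ℝ) + ρ) - Poly.eval gp ((((PolyMP.panelCentre (c / (2 * m)) (m - 1) : ℚ) : ℝ) + ρ) - t)) / t)) Htm)
    {PsiFar Pc Ps Eyp Eym : MI} (hFar : MI.mem S (weilArchTail (2 * (c : ℝ))) PsiFar)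
    (hPc : MI.mem S (∫ x in (-(c : ℝ))..c, Poly.eval gp x * Real.cosh (x / 2)) Pc)
    (hPs : MI.mem S (∫ x in (-(c : ℝ))..c, Poly.eval gp x * Real.sinh (x / 2)) Ps)
    (hEyp : MI.mem S (Real.exp ((PolyMP.panelCentre (c / (2 * m)) (m - 1) : ℝ) / 2)) Eyp)
    (hEym : MI.mem S (Real.exp (-((PolyMP.panelCentre (c / (2 * m)) (m - 1) : ℝ) / 2))) Eym)
    (s1 s2 s3 : MI × MI × Bool × Bool) {w1 L1 w2 L2 w3 L3 : ℝ}
    (hw1 : MI.mem S w1 s1.1) (hL1 : MI.mem S L1 s1.2.1) (hw2 : MI.mem S w2 s2.1) (hL2 : MI.mem S L2 s2.2.1)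
    (hw3 : MI.mem S w3 s3.1) (hL3 : MI.mem S L3 s3.2.1)
    {Qinv : Poly} {e : ℕ} (hcheck : weilArchTailRegKernelCheck S (c / (2 * m)) Dl K Qinv e = true) (pK : Poly)
    {C0 : MI} (hC0 : MI.mem S (Real.log 2 + Real.pi / 4) C0) :
    TMem S (c / (2 * m)) (fun ρ ↦
      (2 * (∫ x in (-(c : ℝ))..c, Poly.eval gp x * Real.cosh (x / 2)) * Real.cosh ((((PolyMP.panelCentre (c / (2 * m)) (m - 1) : ℚ) : ℝ) + ρ) / 2) -
        2 * (∫ x in (-(c : ℝ))..c, Poly.eval gp x * Real.sinh (x / 2)) * Real.sinh ((((PolyMP.panelCentre (c / (2 * m)) (m - 1) : ℚ) : ℝ) + ρ) / 2)) +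
      (dt_primeSlotFn gp w1 L1 s1.2.2.1 s1.2.2.2 (((PolyMP.panelCentre (c / (2 * m)) (m - 1) : ℚ) : ℝ) + ρ) + dt_primeSlotFn gp w2 L2 s2.2.2.1 s2.2.2.2 (((PolyMP.panelCentre (c / (2 * m)) (m - 1) : ℚ) : ℝ) + ρ) +
        dt_primeSlotFn gp w3 L3 s3.2.2.1 s3.2.2.2 (((PolyMP.panelCentre (c / (2 * m)) (m - 1) : ℚ) : ℝ) + ρ)) +
      ((∫ t in Ioc 0 ((c : ℝ) - (((PolyMP.panelCentre (c / (2 * m)) (m - 1) : ℚ) : ℝ) + ρ)),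
          weilArchDensityG t * ((2 * Poly.eval gp (((PolyMP.panelCentre (c / (2 * m)) (m - 1) : ℚ) : ℝ) + ρ) - Poly.eval gp ((((PolyMP.panelCentre (c / (2 * m)) (m - 1) : ℚ) : ℝ) + ρ) - t) - Poly.eval gp ((((PolyMP.panelCentre (c / (2 * m)) (m - 1) : ℚ) : ℝ) + ρ) + t)) / t)) +
        ∫ t in Ioc ((c : ℝ) - (((PolyMP.panelCentre (c / (2 * m)) (m - 1) : ℚ) : ℝ) + ρ)) ((c : ℝ) + (((PolyMP.panelCentre (c / (2 * m)) (m - 1) : ℚ) : ℝ) + ρ)),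
          weilArchDensityG t * ((Poly.eval gp (((PolyMP.panelCentre (c / (2 * m)) (m - 1) : ℚ) : ℝ) + ρ) - Poly.eval gp ((((PolyMP.panelCentre (c / (2 * m)) (m - 1) : ℚ) : ℝ) + ρ) - t)) / t)) +
      Poly.eval gp (((PolyMP.panelCentre (c / (2 * m)) (m - 1) : ℚ) : ℝ) + ρ) * (weilArchTailRegAn (((c / (2 * m) : ℚ) : ℝ) + -ρ) + weilArchTail ((c : ℝ) + (((PolyMP.panelCentre (c / (2 * m)) (m - 1) : ℚ) : ℝ) + ρ))) +
      Poly.eval pk (((PolyMP.panelCentre (c / (2 * m)) (m - 1) : ℚ) : ℝ) + ρ))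
      (dt_residualEdgeLocTM' S c m Dl K gp pk Dρ PsiFar Pc Ps Eyp Eym s1 s2 s3 Qinv e pK C0 Etm Htm) := by
  set h : ℚ := c / (2 * m) with hh
  set y0 : ℚ := PolyMP.panelCentre h (m - 1) with hy0
  have hm0 : 0 < m := by omega
  have hmq : (0 : ℚ) < m := by exact_mod_cast hm0
  have hh0 : 0 < h := by rw [hh]; positivity
  have hhle2 : h ≤ 2 := by linarith
  have hgc : Continuous fun x ↦ Poly.eval gp x := Poly.continuous_eval gp
  have hloc := dt_locI_spec hS gp (mem_ofRat S y0)
  have hGy : TMem S h (fun s ↦ Poly.eval gp ((y0 : ℝ) + s)) (ttruncI S h Dl (dt_locI S gp (ofRat S y0))) :=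
    tmem_trunc hh0.le Dl (dt_tmem_locI hS h gp (mem_ofRat S y0))
  have hpole := dt_tmem_poleTM hS hh0.le hhle2 hK hPc hPs (y0 := (y0 : ℝ)) hEyp hEym
  have hpr := tmem_add (tmem_add (dt_tmem_primeLocTM hS hh0.le Dl gp y0 hGy s1 hw1 hL1)
    (dt_tmem_primeLocTM hS hh0.le Dl gp y0 hGy s2 hw2 hL2)) (dt_tmem_primeLocTM hS hh0.le Dl gp y0 hGy s3 hw3 hL3)
  -- tails
  have hFar' : MI.mem S (weilArchTail (2 * Dρ.length * h)) PsiFar := by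
    have e1 : (2 * Dρ.length * h : ℝ) = 2 * (c : ℝ) := by
      rw [hDρl, hh]; push_cast; field_simp
    rwa [e1]
  have hjfN : 2 * m - 1 < Dρ.length := by rw [hDρl]; omega
  have hfarT := tmem_weilArchTailTM hS hh0 Dρ (by omega : 1 ≤ 2 * m - 1) hjfN hDρ hFar'
  have hcf : ((PolyMP.panelCentre h (2 * m - 1) : ℚ) : ℝ) = (c : ℝ) + (y0 : ℝ) := by
    rw [hy0, hh, show 2 * m - 1 = m + (m - 1) by omega]; exact (dt_c_add_y0 (c := c) (k := m - 1) hm0).symm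
  have hreg := tmem_refl (tmem_weilArchTailRegAnTM hS hh0 (by rw [hh]; exact hh2) hK hcheck pK hC0)
  have hpsi := tmem_mul hS hh0.le Dl hGy (tmem_add hreg hfarT)
  have hpk := dt_tmem_locTM hS hh0.le Dl pk (mem_ofRat S y0)
  have hall := tmem_trunc hh0.le Dl (tmem_add (tmem_add (tmem_add (tmem_add hpole hpr) (tmem_add hE hH)) hpsi) hpk)
  refine tmem_congr_on hall fun ρ _ ↦ ?_
  rw [hcf]
  have e2 : (c : ℝ) + (y0 : ℝ) + ρ = (c : ℝ) + ((y0 : ℝ) + ρ) := by ring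
  rw [e2]

end EdgeResidual

/-! ## The L² bound of the edge panel from the regular-part model -/

section EdgeBound

variable {S : ℕ} {c : ℚ} {m : ℕ}

/-- `a ℓ ≤ max (a l⁻) (a l⁺)` for `l⁻ ≤ ℓ ≤ l⁺`. -/
theorem dt_mulL_le_max {a ℓ llo lhi : ℝ} (h1 : llo ≤ ℓ) (h2 : ℓ ≤ lhi) : a * ℓ ≤ max (a * llo) (a * lhi) := by
  rcases le_total 0 a with ha | ha
  · exact (mul_le_mul_of_nonneg_left h2 ha).trans (le_max_right _ _)
  · exact (mul_le_mul_of_nonpos_left h1 ha).trans (le_max_left _ _)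

/-- `a ℓ² ≤ max (a l⁻²) (a l⁺²)` for `l⁻ ≤ ℓ ≤ l⁺ ≤ 0`. -/
theorem dt_mulL_sq_le_max {a ℓ llo lhi : ℝ} (h1 : llo ≤ ℓ) (h2 : ℓ ≤ lhi) (h3 : lhi ≤ 0) :
    a * ℓ ^ 2 ≤ max (a * llo ^ 2) (a * lhi ^ 2) := by
  have hsq1 : lhi ^ 2 ≤ ℓ ^ 2 := by nlinarith
  have hsq2 : ℓ ^ 2 ≤ llo ^ 2 := by nlinarith
  rcases le_total 0 a with ha | ha
  · exact (mul_le_mul_of_nonneg_left hsq2 ha).trans (le_max_left _ _)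
  · exact (mul_le_mul_of_nonpos_left hsq1 ha).trans (le_max_right _ _)

/-- The edge-rule expression is bounded by its corner evaluation in `ℓ ∈ [l⁻, l⁺]`, `l⁺ ≤ 0`. -/
theorem dt_edgeExprL_le {M1 M2 M3 N1 N2 I δ A B hh ℓ llo lhi : ℝ} (hδ : 0 ≤ δ) (hA : 0 ≤ A) (hh0 : 0 ≤ hh)
    (h1 : llo ≤ ℓ) (h2 : ℓ ≤ lhi) (h3 : lhi ≤ 0) :
    (1 / 4) * (M1 * ℓ ^ 2 - 2 * M2 * ℓ + 2 * M3) - (N1 * ℓ - N2) + I + δ * A * (hh * (1 - ℓ)) + B ≤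
      (1 / 4) * (max (M1 * llo ^ 2) (M1 * lhi ^ 2) - 2 * min (M2 * llo) (M2 * lhi) + 2 * M3) -
        (min (N1 * llo) (N1 * lhi) - N2) + I + δ * A * (hh * (1 - llo)) + B := by
  have a1 := dt_mulL_sq_le_max (a := M1) h1 h2 h3
  have a2 : min (M2 * llo) (M2 * lhi) ≤ M2 * ℓ := by
    have := dt_mulL_le_max (a := -M2) h1 h2
    rw [neg_mul, neg_mul, neg_mul, max_neg_neg] at this
    linarith
  have a3 : min (N1 * llo) (N1 * lhi) ≤ N1 * ℓ := by
    have := dt_mulL_le_max (a := -N1) h1 h2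
    rw [neg_mul, neg_mul, neg_mul, max_neg_neg] at this
    linarith
  have a4 : δ * A * (hh * (1 - ℓ)) ≤ δ * A * (hh * (1 - llo)) :=
    mul_le_mul_of_nonneg_left (mul_le_mul_of_nonneg_left (by linarith) hh0) (mul_nonneg hδ hA)
  linarith

/-- The rational edge bound: corner evaluation of the edge rule with `q = Poly.shift g c`, reference `p`, model `P`. -/
def dt_edgeBoundLQ (S : ℕ) (h : ℚ) (P : IPoly) (q p : Poly) (llo lhi : ℚ) : ℚ :=
  let M1 := powMomQ (Poly.mul q q) (2 * h) 1
  let M2 := powMomQ (Poly.mul q q) (2 * h) 2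
  let M3 := powMomQ (Poly.mul q q) (2 * h) 3
  let N1 := powMomQ (Poly.mul q (Poly.shift p h)) (2 * h) 1
  let N2 := powMomQ (Poly.mul q (Poly.shift p h)) (2 * h) 2
  let δ : ℚ := (tabsI S h (tsubI P (ratPolyI S p)) : ℚ) / S
  (1 / 4) * (max (M1 * llo ^ 2) (M1 * lhi ^ 2) - 2 * min (M2 * llo) (M2 * lhi) + 2 * M3) -
    (min (N1 * llo) (N1 * lhi) - N2) + integPolyQ p p h + δ * absBoundQ (Poly.shift q h) h * (2 * h * (1 - llo)) +
    2 * h * (2 * absBoundQ p h * δ + δ ^ 2)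

/-- **The bound of the edge panel from a model of the regular part.**  `m ≥ 1`, `2h ≤ 1`; `hT`: a Taylor model `P` of the
regular part `T` (flag form); the flags agree with the window memberships on the panel (`hfl`); `R` is the real residual
(indicator form) on the panel; then `∫_{-h}^{h} R(y_{m−1}+ρ)² ≤ dt_edgeBoundLQ S h P (Poly.shift g c) p l⁻ l⁺` for any
reference `p` and bracket `l⁻ ≤ log(2h) ≤ l⁺ ≤ 0`. [cite: Bombieri2000Weil, Thm 2] -/
theorem dt_edgeBoundL_of_tmem (hS : 0 < S) (hc : 0 < c) (hm : 1 ≤ m) (hh2 : 2 * (c / (2 * m)) ≤ 1) (gp pk : Poly)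
    {s1 s2 s3 : MI × MI × Bool × Bool} {w1 L1 w2 L2 w3 L3 : ℝ} {P : IPoly}
    (hT : TMem S (c / (2 * m)) (fun ρ ↦
      (2 * (∫ x in (-(c : ℝ))..c, Poly.eval gp x * Real.cosh (x / 2)) * Real.cosh ((((PolyMP.panelCentre (c / (2 * m)) (m - 1) : ℚ) : ℝ) + ρ) / 2) -
        2 * (∫ x in (-(c : ℝ))..c, Poly.eval gp x * Real.sinh (x / 2)) * Real.sinh ((((PolyMP.panelCentre (c / (2 * m)) (m - 1) : ℚ) : ℝ) + ρ) / 2)) +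
      (dt_primeSlotFn gp w1 L1 s1.2.2.1 s1.2.2.2 (((PolyMP.panelCentre (c / (2 * m)) (m - 1) : ℚ) : ℝ) + ρ) + dt_primeSlotFn gp w2 L2 s2.2.2.1 s2.2.2.2 (((PolyMP.panelCentre (c / (2 * m)) (m - 1) : ℚ) : ℝ) + ρ) +
        dt_primeSlotFn gp w3 L3 s3.2.2.1 s3.2.2.2 (((PolyMP.panelCentre (c / (2 * m)) (m - 1) : ℚ) : ℝ) + ρ)) +
      ((∫ t in Ioc 0 ((c : ℝ) - (((PolyMP.panelCentre (c / (2 * m)) (m - 1) : ℚ) : ℝ) + ρ)),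
          weilArchDensityG t * ((2 * Poly.eval gp (((PolyMP.panelCentre (c / (2 * m)) (m - 1) : ℚ) : ℝ) + ρ) - Poly.eval gp ((((PolyMP.panelCentre (c / (2 * m)) (m - 1) : ℚ) : ℝ) + ρ) - t) - Poly.eval gp ((((PolyMP.panelCentre (c / (2 * m)) (m - 1) : ℚ) : ℝ) + ρ) + t)) / t)) +
        ∫ t in Ioc ((c : ℝ) - (((PolyMP.panelCentre (c / (2 * m)) (m - 1) : ℚ) : ℝ) + ρ)) ((c : ℝ) + (((PolyMP.panelCentre (c / (2 * m)) (m - 1) : ℚ) : ℝ) + ρ)),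
          weilArchDensityG t * ((Poly.eval gp (((PolyMP.panelCentre (c / (2 * m)) (m - 1) : ℚ) : ℝ) + ρ) - Poly.eval gp ((((PolyMP.panelCentre (c / (2 * m)) (m - 1) : ℚ) : ℝ) + ρ) - t)) / t)) +
      Poly.eval gp (((PolyMP.panelCentre (c / (2 * m)) (m - 1) : ℚ) : ℝ) + ρ) * (weilArchTailRegAn (((c / (2 * m) : ℚ) : ℝ) + -ρ) + weilArchTail ((c : ℝ) + (((PolyMP.panelCentre (c / (2 * m)) (m - 1) : ℚ) : ℝ) + ρ))) +
      Poly.eval pk (((PolyMP.panelCentre (c / (2 * m)) (m - 1) : ℚ) : ℝ) + ρ)) P)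
    (hfl : ∀ ρ : ℝ, |ρ| ≤ ((c / (2 * m) : ℚ) : ℝ) →
      (s1.2.2.1 = true ↔ (((PolyMP.panelCentre (c / (2 * m)) (m - 1) : ℚ) : ℝ) + ρ) - L1 ∈ Icc (-(c : ℝ)) c) ∧
      (s1.2.2.2 = true ↔ (((PolyMP.panelCentre (c / (2 * m)) (m - 1) : ℚ) : ℝ) + ρ) + L1 ∈ Icc (-(c : ℝ)) c) ∧
      (s2.2.2.1 = true ↔ (((PolyMP.panelCentre (c / (2 * m)) (m - 1) : ℚ) : ℝ) + ρ) - L2 ∈ Icc (-(c : ℝ)) c) ∧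
      (s2.2.2.2 = true ↔ (((PolyMP.panelCentre (c / (2 * m)) (m - 1) : ℚ) : ℝ) + ρ) + L2 ∈ Icc (-(c : ℝ)) c) ∧
      (s3.2.2.1 = true ↔ (((PolyMP.panelCentre (c / (2 * m)) (m - 1) : ℚ) : ℝ) + ρ) - L3 ∈ Icc (-(c : ℝ)) c) ∧
      (s3.2.2.2 = true ↔ (((PolyMP.panelCentre (c / (2 * m)) (m - 1) : ℚ) : ℝ) + ρ) + L3 ∈ Icc (-(c : ℝ)) c))
    (R : ℝ → ℝ)
    (hR : ∀ ρ : ℝ, |ρ| ≤ ((c / (2 * m) : ℚ) : ℝ) → ρ < ((c / (2 * m) : ℚ) : ℝ) → R (((PolyMP.panelCentre (c / (2 * m)) (m - 1) : ℚ) : ℝ) + ρ) =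
      (2 * (∫ x in (-(c : ℝ))..c, Poly.eval gp x * Real.cosh (x / 2)) * Real.cosh ((((PolyMP.panelCentre (c / (2 * m)) (m - 1) : ℚ) : ℝ) + ρ) / 2) -
        2 * (∫ x in (-(c : ℝ))..c, Poly.eval gp x * Real.sinh (x / 2)) * Real.sinh ((((PolyMP.panelCentre (c / (2 * m)) (m - 1) : ℚ) : ℝ) + ρ) / 2)) +
      (w1 * (2 * Poly.eval gp (((PolyMP.panelCentre (c / (2 * m)) (m - 1) : ℚ) : ℝ) + ρ) - (Icc (-(c : ℝ)) c).indicator (fun x ↦ Poly.eval gp x) ((((PolyMP.panelCentre (c / (2 * m)) (m - 1) : ℚ) : ℝ) + ρ) - L1) - (Icc (-(c : ℝ)) c).indicator (fun x ↦ Poly.eval gp x) ((((PolyMP.panelCentre (c / (2 * m)) (m - 1) : ℚ) : ℝ) + ρ) + L1)) +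
        w2 * (2 * Poly.eval gp (((PolyMP.panelCentre (c / (2 * m)) (m - 1) : ℚ) : ℝ) + ρ) - (Icc (-(c : ℝ)) c).indicator (fun x ↦ Poly.eval gp x) ((((PolyMP.panelCentre (c / (2 * m)) (m - 1) : ℚ) : ℝ) + ρ) - L2) - (Icc (-(c : ℝ)) c).indicator (fun x ↦ Poly.eval gp x) ((((PolyMP.panelCentre (c / (2 * m)) (m - 1) : ℚ) : ℝ) + ρ) + L2)) +
        w3 * (2 * Poly.eval gp (((PolyMP.panelCentre (c / (2 * m)) (m - 1) : ℚ) : ℝ) + ρ) - (Icc (-(c : ℝ)) c).indicator (fun x ↦ Poly.eval gp x) ((((PolyMP.panelCentre (c / (2 * m)) (m - 1) : ℚ) : ℝ) + ρ) - L3) - (Icc (-(c : ℝ)) c).indicator (fun x ↦ Poly.eval gp x) ((((PolyMP.panelCentre (c / (2 * m)) (m - 1) : ℚ) : ℝ) + ρ) + L3))) +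
      ((∫ t in Ioc 0 ((c : ℝ) - (((PolyMP.panelCentre (c / (2 * m)) (m - 1) : ℚ) : ℝ) + ρ)),
          weilArchDensityG t * ((2 * Poly.eval gp (((PolyMP.panelCentre (c / (2 * m)) (m - 1) : ℚ) : ℝ) + ρ) - Poly.eval gp ((((PolyMP.panelCentre (c / (2 * m)) (m - 1) : ℚ) : ℝ) + ρ) - t) - Poly.eval gp ((((PolyMP.panelCentre (c / (2 * m)) (m - 1) : ℚ) : ℝ) + ρ) + t)) / t)) +
        ∫ t in Ioc ((c : ℝ) - (((PolyMP.panelCentre (c / (2 * m)) (m - 1) : ℚ) : ℝ) + ρ)) ((c : ℝ) + (((PolyMP.panelCentre (c / (2 * m)) (m - 1) : ℚ) : ℝ) + ρ)),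
          weilArchDensityG t * ((Poly.eval gp (((PolyMP.panelCentre (c / (2 * m)) (m - 1) : ℚ) : ℝ) + ρ) - Poly.eval gp ((((PolyMP.panelCentre (c / (2 * m)) (m - 1) : ℚ) : ℝ) + ρ) - t)) / t)) +
      Poly.eval gp (((PolyMP.panelCentre (c / (2 * m)) (m - 1) : ℚ) : ℝ) + ρ) * (weilArchTail ((c : ℝ) - (((PolyMP.panelCentre (c / (2 * m)) (m - 1) : ℚ) : ℝ) + ρ)) + weilArchTail ((c : ℝ) + (((PolyMP.panelCentre (c / (2 * m)) (m - 1) : ℚ) : ℝ) + ρ))) +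
      Poly.eval pk (((PolyMP.panelCentre (c / (2 * m)) (m - 1) : ℚ) : ℝ) + ρ))
    (hRi : IntervalIntegrable (fun ρ ↦ R (((PolyMP.panelCentre (c / (2 * m)) (m - 1) : ℚ) : ℝ) + ρ) ^ 2) volume (-((c / (2 * m) : ℚ) : ℝ)) ((c / (2 * m) : ℚ) : ℝ))
    (p : Poly) {llo lhi : ℚ} (hllo : (llo : ℝ) ≤ Real.log (2 * ((c / (2 * m) : ℚ) : ℝ)))
    (hlhi : Real.log (2 * ((c / (2 * m) : ℚ) : ℝ)) ≤ lhi) (hlhi0 : lhi ≤ 0) :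
    ∫ ρ in (-((c / (2 * m) : ℚ) : ℝ))..((c / (2 * m) : ℚ) : ℝ), R (((PolyMP.panelCentre (c / (2 * m)) (m - 1) : ℚ) : ℝ) + ρ) ^ 2 ≤
      ((dt_edgeBoundLQ S (c / (2 * m)) P (Poly.shift gp c) p llo lhi : ℚ) : ℝ) := by
  set h : ℚ := c / (2 * m) with hh
  set y0 : ℚ := PolyMP.panelCentre h (m - 1) with hy0
  have hm0 : 0 < m := hm
  have hmq : (0 : ℚ) < m := by exact_mod_cast hm0
  have hh0 : 0 < h := by rw [hh]; positivity
  have hhr : (0 : ℝ) < h := by exact_mod_cast hh0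
  have hh1r : 2 * (h : ℝ) ≤ 1 := by exact_mod_cast hh2
  have hy0v : ((y0 : ℚ) : ℝ) = (c : ℝ) - h := by
    have e1 := dt_tI_eq h (m - 1)
    have hc2 : (c : ℝ) = 2 * m * h := by rw [hh]; push_cast; field_simp
    rw [hy0, e1, hc2]; push_cast [Nat.cast_sub hm]; ring
  -- the edge function `R_e(s) = R(c − s) = R(y0 + (h − s))`
  set Re : ℝ → ℝ := fun s ↦ R ((y0 : ℝ) + ((h : ℝ) - s)) with hRe
  have hcv : ∫ ρ in (-(h : ℝ))..h, R ((y0 : ℝ) + ρ) ^ 2 = ∫ s in (0 : ℝ)..(2 * h), Re s ^ 2 := by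
    have hs := intervalIntegral.integral_comp_sub_left (fun ρ ↦ R ((y0 : ℝ) + ρ) ^ 2) (h : ℝ) (a := 0) (b := 2 * h)
    simp only [sub_zero] at hs
    rw [show (h : ℝ) - 2 * h = -h by ring] at hs
    rw [← hs]
  have hRei : IntervalIntegrable (fun s ↦ Re s ^ 2) volume 0 (2 * h) := by
    have := (hRi.comp_sub_left (h : ℝ)).symm
    have e1 : (fun s ↦ Re s ^ 2) = fun x ↦ R ((y0 : ℝ) + ((h : ℝ) - x)) ^ 2 := by rw [hRe]
    rw [e1, show (0 : ℝ) = (h : ℝ) - h by ring, show 2 * (h : ℝ) = (h : ℝ) - (-(h : ℝ)) by ring]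
    exact this
  have hmain := integral_sq_logEdge_le_loc hS hh0 hh2 hT (Poly.shift gp c) p (R := Re) (fun s hs ↦ by
    have hs1 : s ≤ 1 := hs.2.trans hh1r
    have hρ : |(h : ℝ) - s| ≤ h := abs_le.2 ⟨by linarith [hs.2], by linarith [hs.1]⟩
    have hρlt : (h : ℝ) - s < h := by linarith [hs.1]
    rw [hRe]
    beta_reduce
    rw [hR _ hρ hρlt]
    obtain ⟨h1a, h1b, h2a, h2b, h3a, h3b⟩ := hfl _ hρ
    rw [← dt_primeSlotFn_eq_indicator gp w1 L1 h1a h1b, ← dt_primeSlotFn_eq_indicator gp w2 L2 h2a h2b,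
      ← dt_primeSlotFn_eq_indicator gp w3 L3 h3a h3b]
    have eys : ((y0 : ℚ) : ℝ) + ((h : ℝ) - s) = (c : ℝ) - s := by rw [hy0v]; ring
    have etail : Poly.eval gp ((y0 : ℝ) + ((h : ℝ) - s)) * weilArchTail ((c : ℝ) - ((y0 : ℝ) + ((h : ℝ) - s))) =
        -(1 / 2) * Poly.eval (Poly.shift gp c) s * Real.log s +
          Poly.eval gp ((y0 : ℝ) + ((h : ℝ) - s)) * weilArchTailRegAn ((h : ℝ) + -((h : ℝ) - s)) := by
      rw [eys, sub_sub_cancel, Poly.eval_shift, show (h : ℝ) + -((h : ℝ) - s) = s by ring,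
        ← weilArchTailReg_eq_an hs.1 hs1, weilArchTailReg]
      ring
    rw [mul_add (Poly.eval gp _) (weilArchTail _) (weilArchTail _), etail]
    ring) hRei
  rw [hcv]
  refine hmain.trans ?_
  have hδ : 0 ≤ (tabsI S h (tsubI P (ratPolyI S p)) : ℝ) / S :=
    (abs_nonneg _).trans (abs_sub_poly_le_of_tmem hS hh0.le hT p (by rw [abs_zero]; exact hhr.le))
  have hA : 0 ≤ ((absBoundQ (Poly.shift (Poly.shift gp c) h) h : ℚ) : ℝ) :=
    (abs_nonneg _).trans (abs_eval_le_absBoundQ (Poly.shift (Poly.shift gp c) h) (y := 0)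
      (by rw [abs_zero]; exact hhr.le))
  have key := dt_edgeExprL_le (M1 := (powMomQ (Poly.mul (Poly.shift gp c) (Poly.shift gp c)) (2 * h) 1 : ℝ))
    (M2 := (powMomQ (Poly.mul (Poly.shift gp c) (Poly.shift gp c)) (2 * h) 2 : ℝ))
    (M3 := (powMomQ (Poly.mul (Poly.shift gp c) (Poly.shift gp c)) (2 * h) 3 : ℝ))
    (N1 := (powMomQ (Poly.mul (Poly.shift gp c) (Poly.shift p h)) (2 * h) 1 : ℝ))
    (N2 := (powMomQ (Poly.mul (Poly.shift gp c) (Poly.shift p h)) (2 * h) 2 : ℝ))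
    (I := (integPolyQ p p h : ℝ))
    (B := 2 * (h : ℝ) * (2 * absBoundQ p h * ((tabsI S h (tsubI P (ratPolyI S p)) : ℝ) / S) +
      ((tabsI S h (tsubI P (ratPolyI S p)) : ℝ) / S) ^ 2))
    hδ hA (hh := 2 * (h : ℝ)) (by positivity) hllo hlhi (by exact_mod_cast hlhi0 : ((lhi : ℚ) : ℝ) ≤ 0)
  refine (le_of_eq ?_).trans (key.trans (le_of_eq ?_))
  · ring
  · simp only [dt_edgeBoundLQ]
    push_cast
    ring

end EdgeBound

end Summit.RiemannHypothesis.RiemannHypothesis.Theorems.EvenWinsBeyondArch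

end
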